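import Mathlib
import Summits.ValiantsHypothesis.ValiantsHypothesis.Theses.FifoMatching
import Summits.ValiantsHypothesis.ValiantsHypothesis.Theorems.FifoMatchingNNLinearDegreeCofactorHardStubLongRunInternalHard
import Summits.ValiantsHypothesis.ValiantsHypothesis.Theorems.FifoMatchingNNDivisionHardFewVerticesCofactor
import Summits.ValiantsHypothesis.ValiantsHypothesis.Theorems.DivisionGapZeroOneTransferProjClosureAux
import Summits.ValiantsHypothesis.ValiantsHypothesis.Theorems.FifoMatchingNNOrderRungOfDegreeRung
import Summits.ValiantsHypothesis.ValiantsHypothesis.Theorems.FifoMatchingNNQuasiPolyLogDegreeCofactorHardHolds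
import Literature.Computability.AlgebraicComplexity.NestFreeMatchingPoly
import HarnessLib

/-!
# Route FifoMatching — crux `NNDivisionHard` (stmt-ValiantsHypothesis-21181): the WINDOW-AVOIDANCE tier
# and the residual enemy class of 21181 in `h`-language, BY NAME

Theorems port (prover hand leafhand-val-fifomatching-1 g4, `--supports stmt-ValiantsHypothesis-21181`) of the
sorry-free crux workfile `Cruxes/NNDivisionHard/WindowAvoidance40.lean` (val-idea-40 g9, sha256 504f968d46d7…),
§1–§4 verbatim up to the namespace (`Cruxes.NNDivisionHard.WindowAvoidance40` ↦
`Theorems.FifoMatching.NNDivisionHard.WindowAvoidance`), so that the tier and the residual are IMPORTABLE.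

`NNDivisionHard`: for every `c` and all large `n`, EVERY nonzero cofactor `h ∈ ℝ≥0[x_(i,j)]` has
`2^((log₂ n + c)^c) < L₊(NN_n · h) + L₊(h)`.  With `G(n,c) := 2·((log₂ n + c)^c + log₂ n + 1)^6 + 12` (the run
length of the landed engine S2a `NNLinearDegreeCofactorHard.stub_longRunInternalHard`) call `G(n,c)` consecutive
vertices `[s, s + G) ⊆ [2n]` a WINDOW.

* `isWeightedHomogeneous_nestFreeMatchingPoly_pot` — `NN_n` is weighted-homogeneous for EVERY vertex potential
  `u` (arc weight `(i,j) ↦ u i + u j`, written inline — no definition); hence over `ℝ≥0` the BOTTOM `u`-component factors,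
  `bot_u (NN_n · h) = NN_n · bot_u h` (`botComponent_nn_mul`), and is free for monotone circuits
  (`complexity_nn_mul_botComponent_le`, via `ProjClosure.complexity_botComponent_le`).
* `botComponent_internal` — for the INDICATOR potential of a window, if SOME monomial of `h` avoids the window then
  `bot_u h` is a nonzero INTERNAL cofactor on the complement of the window (any degree).
* ★ `nnDivisionHard_of_windowAvoidingMonomial` — the conclusion of `NNDivisionHard` for every nonzero `h` having AT
  LEAST ONE monomial none of whose arc variables has an endpoint in some window (S2a by name on the bottom component).
* `nnDivisionHard_of_sparseMonomial` — hence for every nonzero `h` with ONE monomial `x^d` on few vertices,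
  `(|V(d)| + 1)·(((log₂ n + c)^c + log₂ n + 1)^6 + 6) ≤ n` («∃ monomial», vs the «∀ monomial» budget of the landed
  `NNLowDegreeCofactorHard.nnDivisionHard_of_vertexSupport_budget`).
* `nnDivisionHard_iff_windowDense` — BY NAME: `Theses.FifoMatching.NNDivisionHard` ⟺ its restriction to
  WINDOW-DENSE cofactors (every monomial meets every window).
* `nnDivisionHard_iff_denseDeepResidual` — with the ORDER rung of record (`NNOrderRung.orderRung_of_rung` ∘
  ✓ `nnQuasiPolyLogDegreeCofactorHard_holds`, stmt-27271): `NNDivisionHard` ⟺ its restriction to cofactors that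
  are window-dense AND deep (all homogeneous components of degree `≤ 2^((log₂ n + k)^k)` vanish, all `k`).

HONEST FRAMING.  A PARTIAL RANGE (species rung) of the OPEN crux `NNDivisionHard` plus the residual by name; the
crux, `NNNotVP` (stmt-11615) and VP ≠ VNP are NOT proved; monotone world only
(`Literature.Barriers.ValiantsHypothesis.MonotoneGap`).  NO definitions (the workfile's bookkeeping `potWeight u` is
spelled out as the lambda `fun e => u e.1 + u e.2`), no named facts, no sorry. [folklore]
-/

noncomputable section

-- Sub = Summit single-conjunct layout: the duplicated namespace component is mandated by the tree.
set_option linter.dupNamespace false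
set_option autoImplicit false

namespace Summit.ValiantsHypothesis.ValiantsHypothesis.Theorems.FifoMatching.NNDivisionHard.WindowAvoidance

open MvPolynomial Finset Literature.Computability.AlgebraicComplexity
open Summit.ValiantsHypothesis.ValiantsHypothesis.Theorems.DivisionGapZeroOneTransfer.ProjClosure
open Summit.ValiantsHypothesis.ValiantsHypothesis.Theorems.FifoMatching.NNLowDegreeCofactorHard
open Summit.ValiantsHypothesis.ValiantsHypothesis.Theorems.FifoMatching.NNLinearDegreeCofactorHard
open scoped NNReal

/-! ### §1 Vertex potentials: `NN_n` is weighted-homogeneous for EVERY potential -/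

/-- The `(u i + u j)`-weight of the arc set of a perfect matching is `Σ_v u v`: every vertex is an endpoint of
exactly one arc (the `B^v ↦ u v` generalisation of `NNLowDegreeCofactorHard.weight_arcExponent`). [folklore] -/
theorem weight_potWeight_arcExponent {m : ℕ} {M : Fin m → Fin m} (hM : M ∈ perfectMatchings m)
    (u : Fin m → ℕ) : Finsupp.weight (fun e : Fin m × Fin m => u e.1 + u e.2) (arcExponent M) = ∑ v : Fin m, u v := by
  classical
  obtain ⟨hinv, hfp⟩ := mem_perfectMatchings.1 hM
  have hinj : Function.Injective M := Function.Involutive.injective hinv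
  rw [arcExponent, map_sum]
  simp only [Finsupp.weight_apply, Finsupp.sum_single_index, zero_smul, one_smul]
  rw [Finset.sum_add_distrib]
  have himg : ∑ i ∈ openers M, u (M i) = ∑ j ∈ (openers M).image M, u j := by
    rw [Finset.sum_image fun i _ j _ h => hinj h]
  rw [himg, image_openers hM, openers]
  have hneg : (Finset.univ.filter fun i : Fin m => M i < i) =
      Finset.univ.filter fun i : Fin m => ¬ i < M i := by
    refine Finset.filter_congr fun i _ => ?_
    constructor
    · exact fun h => not_lt.2 h.le
    · exact fun h => lt_of_le_of_ne (not_lt.1 h) (hfp i)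
  rw [hneg, Finset.sum_filter_add_sum_filter_not]

/-- **`NN_n` is `(u i + u j)`-weighted-homogeneous of weight `Σ_v u v` for every vertex potential `u`.** [folklore] -/
theorem isWeightedHomogeneous_nestFreeMatchingPoly_pot (n : ℕ) (u : Fin (2 * n) → ℕ) :
    IsWeightedHomogeneous (fun e : Fin (2 * n) × Fin (2 * n) => u e.1 + u e.2) (nestFreeMatchingPoly n ℝ≥0) (∑ v : Fin (2 * n), u v) := by
  rw [nestFreeMatchingPoly_eq_sum_arcMonomial]
  refine IsWeightedHomogeneous.sum _ _ _ fun M hM => ?_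
  rw [arcMonomial_eq_monomial]
  exact isWeightedHomogeneous_monomial _ _ _
    (weight_potWeight_arcExponent (nestFreeMatchings_subset_perfectMatchings hM) u)

/-! ### §2 Bottom components for a vertex potential (free over `ℝ≥0`) -/

/-- `bot_w (NN_n · h) = NN_n · bot_w h` for every vertex potential (`NN_n` is `w`-homogeneous, bottom components
are multiplicative over `ℝ≥0`). [folklore] -/
theorem botComponent_nn_mul (n : ℕ) (u : Fin (2 * n) → ℕ)
    (h : MvPolynomial (Fin (2 * n) × Fin (2 * n)) ℝ≥0) :
    botComponent (fun e : Fin (2 * n) × Fin (2 * n) => u e.1 + u e.2) (nestFreeMatchingPoly n ℝ≥0 * h) =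
      nestFreeMatchingPoly n ℝ≥0 *
        botComponent (fun e : Fin (2 * n) × Fin (2 * n) => u e.1 + u e.2) h := by
  rw [botComponent_mul, botComponent_eq_self_of_isWeightedHomogeneous _
    (isWeightedHomogeneous_nestFreeMatchingPoly_pot n u)]

/-- **Passing to the bottom component of the cofactor is free:** `L₊(NN_n · bot_w h) ≤ L₊(NN_n · h)`
(`ProjClosure.complexity_botComponent_le`). [folklore] -/
theorem complexity_nn_mul_botComponent_le (n : ℕ) (u : Fin (2 * n) → ℕ)
    (h : MvPolynomial (Fin (2 * n) × Fin (2 * n)) ℝ≥0) :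
    complexity (nestFreeMatchingPoly n ℝ≥0 *
        botComponent (fun e : Fin (2 * n) × Fin (2 * n) => u e.1 + u e.2) h) ≤
      complexity (nestFreeMatchingPoly n ℝ≥0 * h) := by
  rw [← botComponent_nn_mul]
  exact complexity_botComponent_le _ _

/-- A monomial has `w`-weight `0` iff every variable occurring in it weighs `0`. [folklore] -/
theorem weight_eq_zero_iff {σ : Type*} (w : σ → ℕ) (d : σ →₀ ℕ) :
    Finsupp.weight w d = 0 ↔ ∀ e ∈ d.support, w e = 0 := by
  classical
  rw [Finsupp.weight_apply, Finsupp.sum, Finset.sum_eq_zero_iff]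
  refine forall₂_congr fun e he => ?_
  have hde : d e ≠ 0 := Finsupp.mem_support_iff.1 he
  show d e • w e = 0 ↔ w e = 0
  rw [smul_eq_mul, mul_eq_zero]
  exact ⟨fun h => h.resolve_left hde, Or.inr⟩

/-- **The window-indicator potential.**  For a vertex predicate `P` (the window) grade `x_(i,j)` by the number of
endpoints satisfying `P`.  If SOME monomial of `h` has no endpoint in the window, then the bottom component of `h` is
supported on monomials with no endpoint in the window: an INTERNAL cofactor on the complement. [folklore] -/
theorem botComponent_internal {m : ℕ} (P : Fin m → Prop) [DecidablePred P]
    {h : MvPolynomial (Fin m × Fin m) ℝ≥0} {d : (Fin m × Fin m) →₀ ℕ} (hd : d ∈ h.support)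
    (havoid : ∀ e ∈ d.support, ¬ P e.1 ∧ ¬ P e.2) :
    ∀ d' ∈ (botComponent (fun e : Fin m × Fin m =>
        (if P e.1 then 1 else 0) + (if P e.2 then 1 else 0)) h).support,
      ∀ e ∈ d'.support, ¬ P e.1 ∧ ¬ P e.2 := by
  classical
  set w : Fin m × Fin m → ℕ := fun e => (if P e.1 then 1 else 0) + (if P e.2 then 1 else 0) with hw
  have hwe : ∀ e : Fin m × Fin m, w e = 0 ↔ ¬ P e.1 ∧ ¬ P e.2 := fun e => by
    show (if P e.1 then 1 else 0) + (if P e.2 then 1 else 0) = 0 ↔ _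
    by_cases h1 : P e.1 <;> by_cases h2 : P e.2 <;> simp [h1, h2]
  have hd0 : Finsupp.weight w d = 0 := (weight_eq_zero_iff w d).2 fun e he => (hwe e).2 (havoid e he)
  have hbot : botDegree w h = 0 := Nat.le_zero.1 (hd0 ▸ botDegree_le w hd)
  intro d' hd' e he
  have hc := mem_support_iff.1 hd'
  rw [coeff_botComponent, hbot] at hc
  have hwd' : Finsupp.weight w d' = 0 := by
    by_contra hne
    exact hc (if_neg hne)
  exact (hwe e).1 ((weight_eq_zero_iff w d').1 hwd' e he)

/-! ### §3 ★ The window-avoidance tier of `NNDivisionHard` -/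

/-- ★ **`NNDivisionHard` for cofactors with a window-avoiding monomial.**  For every `c` there is `n₀` such that for
all `n ≥ n₀` and every nonzero `h ∈ ℝ≥0[x_(i,j)]`: if SOME monomial of `h` avoids SOME window
`[s, s + G(n,c)) ⊆ [2n]`, then `2^((log₂ n + c)^c) < L₊(NN_n · h) + L₊(h)` — whatever the degree of that monomial and
whatever the other monomials of `h`.  Proof: bottom component for the window potential (free; a nonzero internal
cofactor on the complement of the window) + S2a `stub_longRunInternalHard` BY NAME; `n₀` = S2a's. [folklore] -/
theorem nnDivisionHard_of_windowAvoidingMonomial :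
    ∀ c : ℕ, ∃ n₀ : ℕ, ∀ n ≥ n₀, ∀ h : MvPolynomial (Fin (2 * n) × Fin (2 * n)) ℝ≥0, h ≠ 0 →
      (∃ s : ℕ, s + (2 * ((Nat.log 2 n + c) ^ c + Nat.log 2 n + 1) ^ 6 + 12) ≤ 2 * n ∧
        ∃ d ∈ h.support, ∀ e ∈ d.support,
          ¬ (s ≤ e.1.val ∧ e.1.val < s + (2 * ((Nat.log 2 n + c) ^ c + Nat.log 2 n + 1) ^ 6 + 12)) ∧
          ¬ (s ≤ e.2.val ∧ e.2.val < s + (2 * ((Nat.log 2 n + c) ^ c + Nat.log 2 n + 1) ^ 6 + 12))) →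
      2 ^ ((Nat.log 2 n + c) ^ c) <
        complexity (nestFreeMatchingPoly n ℝ≥0 * h) + complexity h := by
  intro c
  obtain ⟨n₀, hn₀⟩ := stub_longRunInternalHard c
  refine ⟨n₀, fun n hn h hh hyp => ?_⟩
  classical
  obtain ⟨s, hs, d, hd, havoid⟩ := hyp
  set G := 2 * ((Nat.log 2 n + c) ^ c + Nat.log 2 n + 1) ^ 6 + 12 with hG
  -- the bottom component of `h` for the window potential: a nonzero internal cofactor on the complement
  have hint := botComponent_internal (fun v : Fin (2 * n) => s ≤ v.val ∧ v.val < s + G) hd havoid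
  set p := botComponent (fun e : Fin (2 * n) × Fin (2 * n) =>
      (if s ≤ e.1.val ∧ e.1.val < s + G then 1 else 0) +
      (if s ≤ e.2.val ∧ e.2.val < s + G then 1 else 0)) h with hp
  have hp0 : p ≠ 0 := botComponent_ne_zero _ hh
  set R : Finset (Fin (2 * n)) := univ.filter fun j => ¬ (s ≤ j.val ∧ j.val < s + G) with hR
  have hrun : ∃ s' : ℕ, s' + G ≤ 2 * n ∧
      ∀ j : Fin (2 * n), s' ≤ j.val → j.val < s' + G → j ∉ R :=
    ⟨s, hs, fun j h1 h2 => by simp [hR, h1, h2]⟩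
  have hintR : ∀ d' ∈ p.support, ∀ e ∈ d'.support, e.1 ∈ R ∧ e.2 ∈ R := fun d' hd' e he => by
    obtain ⟨h1, h2⟩ := hint d' hd' e he
    exact ⟨mem_filter.2 ⟨mem_univ _, h1⟩, mem_filter.2 ⟨mem_univ _, h2⟩⟩
  -- S2a, by name
  have hS2a := hn₀ n hn R hrun p hp0 hintR
  calc 2 ^ ((Nat.log 2 n + c) ^ c) < complexity (nestFreeMatchingPoly n ℝ≥0 * p) := hS2a
    _ ≤ complexity (nestFreeMatchingPoly n ℝ≥0 * h) :=
        complexity_nn_mul_botComponent_le n (fun v : Fin (2 * n) => if s ≤ v.val ∧ v.val < s + G then 1 else 0) h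
    _ ≤ complexity (nestFreeMatchingPoly n ℝ≥0 * h) + complexity h := Nat.le_add_right _ _

/-- **`NNDivisionHard` for cofactors with ONE sparse monomial** (block pigeonhole + ★): for every `c` and all large
`n`, every nonzero `h` having some monomial `x^d` with `(|V(d)| + 1)·(((log₂ n + c)^c + log₂ n + 1)^6 + 6) ≤ n`
(`V(d) = vertexSupport d`, the endpoints of the arc variables of `x^d`; the degree of `x^d` and the other monomials of
`h` are arbitrary) satisfies `2^((log₂ n + c)^c) < L₊(NN_n · h) + L₊(h)`.  Membership test «∃ monomial on few
vertices» vs the «∀ monomial» (`h.support.sup`) of `nnDivisionHard_of_vertexSupport_budget`. [folklore] -/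
theorem nnDivisionHard_of_sparseMonomial :
    ∀ c : ℕ, ∃ n₀ : ℕ, ∀ n ≥ n₀, ∀ h : MvPolynomial (Fin (2 * n) × Fin (2 * n)) ℝ≥0, h ≠ 0 →
      (∃ d ∈ h.support,
        ((vertexSupport d).card + 1) * (((Nat.log 2 n + c) ^ c + Nat.log 2 n + 1) ^ 6 + 6) ≤ n) →
      2 ^ ((Nat.log 2 n + c) ^ c) <
        complexity (nestFreeMatchingPoly n ℝ≥0 * h) + complexity h := by
  intro c
  obtain ⟨n₀, hn₀⟩ := nnDivisionHard_of_windowAvoidingMonomial c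
  refine ⟨n₀, fun n hn h hh hyp => ?_⟩
  classical
  obtain ⟨d, hd, hbudget⟩ := hyp
  obtain ⟨m, hm⟩ : ∃ m : ℕ, m = ((Nat.log 2 n + c) ^ c + Nat.log 2 n + 1) ^ 6 + 6 := ⟨_, rfl⟩
  rw [← hm] at hbudget
  have hmpos : 0 < m := by rw [hm]; positivity
  have hGm : 2 * ((Nat.log 2 n + c) ^ c + Nat.log 2 n + 1) ^ 6 + 12 = 2 * m := by rw [hm]; ring
  obtain ⟨k, hk, hfree⟩ := FreedVertices.Carve.exists_free_block (vertexSupport d) hmpos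
  have hmk : m * k + m ≤ n :=
    calc m * k + m ≤ m * (vertexSupport d).card + m :=
          Nat.add_le_add_right (Nat.mul_le_mul_left m hk) m
      _ = ((vertexSupport d).card + 1) * m := by ring
      _ ≤ n := hbudget
  refine hn₀ n hn h hh ⟨2 * m * k, ?_, d, hd, fun e he => ?_⟩
  · rw [hGm, show 2 * m * k + 2 * m = 2 * (m * k + m) by ring]
    exact Nat.mul_le_mul_left 2 hmk
  · have h1 : e.1 ∈ vertexSupport d := by
      unfold vertexSupport; exact mem_union_left _ (mem_image_of_mem _ he)
    have h2 : e.2 ∈ vertexSupport d := by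
      unfold vertexSupport; exact mem_union_right _ (mem_image_of_mem _ he)
    rw [hGm]
    exact ⟨hfree _ h1, hfree _ h2⟩

/-! ### §4 The residual of 21181 in `h`-language, BY NAME against the route decl -/

/-- **`NNDivisionHard` ⟺ `NNDivisionHard` for WINDOW-DENSE cofactors** (every monomial has an arc endpoint in every
window that fits in `[2n]`): the others are decided by ★.  (`NN_n` inlined in the route decl is definitionally `nestFreeMatchingPoly n ℝ≥0`.)
[folklore] -/
theorem nnDivisionHard_iff_windowDense :
    Summit.ValiantsHypothesis.ValiantsHypothesis.Theses.FifoMatching.NNDivisionHard ↔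
      ∀ c : ℕ, ∃ n₀ : ℕ, ∀ n ≥ n₀, ∀ h : MvPolynomial (Fin (2 * n) × Fin (2 * n)) ℝ≥0, h ≠ 0 →
        (∀ d ∈ h.support, ∀ s : ℕ,
          s + (2 * ((Nat.log 2 n + c) ^ c + Nat.log 2 n + 1) ^ 6 + 12) ≤ 2 * n →
          ∃ e ∈ d.support,
            (s ≤ e.1.val ∧ e.1.val < s + (2 * ((Nat.log 2 n + c) ^ c + Nat.log 2 n + 1) ^ 6 + 12)) ∨
            (s ≤ e.2.val ∧ e.2.val < s + (2 * ((Nat.log 2 n + c) ^ c + Nat.log 2 n + 1) ^ 6 + 12))) →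
        2 ^ ((Nat.log 2 n + c) ^ c) <
          complexity (nestFreeMatchingPoly n ℝ≥0 * h) + complexity h := by
  constructor
  · intro H c
    obtain ⟨n₀, hn₀⟩ := H c
    exact ⟨n₀, fun n hn h hh _ => hn₀ n hn h hh⟩
  · intro H c
    obtain ⟨n₁, hn₁⟩ := H c
    obtain ⟨n₂, hn₂⟩ := nnDivisionHard_of_windowAvoidingMonomial c
    refine ⟨max n₁ n₂, fun n hn h hh => ?_⟩
    by_cases hav : ∃ s : ℕ, s + (2 * ((Nat.log 2 n + c) ^ c + Nat.log 2 n + 1) ^ 6 + 12) ≤ 2 * n ∧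
        ∃ d ∈ h.support, ∀ e ∈ d.support,
          ¬ (s ≤ e.1.val ∧ e.1.val < s + (2 * ((Nat.log 2 n + c) ^ c + Nat.log 2 n + 1) ^ 6 + 12)) ∧
          ¬ (s ≤ e.2.val ∧ e.2.val < s + (2 * ((Nat.log 2 n + c) ^ c + Nat.log 2 n + 1) ^ 6 + 12))
    · exact hn₂ n (le_of_max_le_right hn) h hh hav
    · refine hn₁ n (le_of_max_le_left hn) h hh fun d hd s hs => ?_
      by_contra hne
      exact hav ⟨s, hs, d, hd, fun e he =>
        ⟨fun h1 => hne ⟨e, he, Or.inl h1⟩, fun h2 => hne ⟨e, he, Or.inr h2⟩⟩⟩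

/-- **THE RESIDUAL ENEMY CLASS OF 21181 IN `h`-LANGUAGE, BY NAME.**  With the ORDER rung of record
(`NNOrderRung.orderRung_of_rung` applied to ✓ `nnQuasiPolyLogDegreeCofactorHard_holds`, stmt-27271) and ★:
`NNDivisionHard` ⟺ its restriction to nonzero cofactors `h` that are WINDOW-DENSE (every monomial meets every window) and
DEEP (every homogeneous component of degree `≤ 2^((log₂ n + k)^k)` vanishes), for all `k, c`, eventually in `n`.
[folklore] -/
theorem nnDivisionHard_iff_denseDeepResidual :
    Summit.ValiantsHypothesis.ValiantsHypothesis.Theses.FifoMatching.NNDivisionHard ↔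
      ∀ k c : ℕ, ∃ n₀ : ℕ, ∀ n ≥ n₀, ∀ h : MvPolynomial (Fin (2 * n) × Fin (2 * n)) ℝ≥0, h ≠ 0 →
        (∀ d ∈ h.support, ∀ s : ℕ,
          s + (2 * ((Nat.log 2 n + c) ^ c + Nat.log 2 n + 1) ^ 6 + 12) ≤ 2 * n →
          ∃ e ∈ d.support,
            (s ≤ e.1.val ∧ e.1.val < s + (2 * ((Nat.log 2 n + c) ^ c + Nat.log 2 n + 1) ^ 6 + 12)) ∨
            (s ≤ e.2.val ∧ e.2.val < s + (2 * ((Nat.log 2 n + c) ^ c + Nat.log 2 n + 1) ^ 6 + 12))) →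
        (∀ e : ℕ, e ≤ 2 ^ ((Nat.log 2 n + k) ^ k) → homogeneousComponent e h = 0) →
        2 ^ ((Nat.log 2 n + c) ^ c) <
          complexity (nestFreeMatchingPoly n ℝ≥0 * h) + complexity h := by
  constructor
  · intro H k c
    obtain ⟨n₀, hn₀⟩ := H c
    exact ⟨n₀, fun n hn h hh _ _ => hn₀ n hn h hh⟩
  · intro H
    refine nnDivisionHard_iff_windowDense.mpr fun c => ?_
    obtain ⟨n₃, hn₃⟩ := H c c
    obtain ⟨n₄, hn₄⟩ :=
      Summit.ValiantsHypothesis.ValiantsHypothesis.Theorems.FifoMatching.NNOrderRung.orderRung_of_rung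
        Summit.ValiantsHypothesis.ValiantsHypothesis.Theorems.FifoMatching.nnQuasiPolyLogDegreeCofactorHard_holds
        c c
    refine ⟨max n₃ n₄, fun n hn h hh hdense => ?_⟩
    by_cases hdeep : ∃ e : ℕ, e ≤ 2 ^ ((Nat.log 2 n + c) ^ c) ∧ homogeneousComponent e h ≠ 0
    · obtain ⟨e, he, hne⟩ := hdeep
      exact (hn₄ n (le_of_max_le_right hn) h e hne he).trans_le (Nat.le_add_right _ _)
    · exact hn₃ n (le_of_max_le_left hn) h hh hdense fun e he => by
        by_contra hne
        exact hdeep ⟨e, he, hne⟩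

end Summit.ValiantsHypothesis.ValiantsHypothesis.Theorems.FifoMatching.NNDivisionHard.WindowAvoidance

end
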